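import Summits.ResolutionOfSingularities.ResolutionOfSingularities.Theorems.RadicialJungCleanModelsSufficeGameDefs

/-!
# Route `RadicialJung`, crux `CleanModelsSuffice`, line `Sketch`: the phase-2 POTENTIAL of the
# exceptionalisation game drops in a phase-2 round

Helper for the skeleton of
`Summit.ResolutionOfSingularities.ResolutionOfSingularities.Theses.RadicialJung.CleanModelsSuffice`
(stmt-ResolutionOfSingularities-15883): with `Φ T = Σ_{D ∈ E} sup_{W D} Nval(·, D)` the phase-2 potential
of a game state (`…GameDefs`), a round of the game whose centre is the bad locus `W D₀` of an exceptional
divisor `D₀` (contract `RoundSpec`) makes `Φ` drop: `GameState.Φ_lt_of_roundSpec`. Also two monotonicity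
lemmas for `sSup` on `ℕ` (`sSup ∅ = 0`).
-/

noncomputable section

set_option linter.dupNamespace false -- mandated namespace of this single-conjunct summit

open CategoryTheory AlgebraicGeometry TopologicalSpace IsLocalRing
open Literature.AlgebraicGeometry.Resolution Literature.AlgebraicGeometry.Motives

namespace Summit.ResolutionOfSingularities.ResolutionOfSingularities.Theorems.RadicialJung.CleanModelsSuffice

/-! ## Monotonicity of suprema of naturals (with `sSup ∅ = 0`) -/

/-- For sets of naturals, `A ⊆ B` with `B` bounded gives `sSup A ≤ sSup B` (also for `A = ∅`).
[folklore] -/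
theorem nat_sSup_le_sSup_of_subset {A B : Set ℕ} (hB : BddAbove B) (h : A ⊆ B) : sSup A ≤ sSup B := by
  rcases A.eq_empty_or_nonempty with rfl | hA
  · simp
  · exact csSup_le_csSup hB hA h

/-- A bounded set of naturals all of whose members are `≤ c` has `sSup ≤ c`. [folklore] -/
theorem nat_sSup_le_of_forall_le {A : Set ℕ} (c : ℕ) (h : ∀ a ∈ A, a ≤ c) : sSup A ≤ c := by
  rcases A.eq_empty_or_nonempty with rfl | hA
  · simp
  · exact csSup_le hA h

/-! ## The potential drops in a phase-2 round -/

section PhaseTwo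

variable {p : ℕ} {V₀ : Scheme.{0}} [IsIntegral V₀] {L : Type} [Field L] [Algebra V₀.functionField L]
  {V : Scheme.{0}} [IsIntegral V] {π : V ⟶ V₀} [IsDominant π]

/-- **The phase-2 potential drops.** If `Z = W D₀` is the bad locus of `D₀ ∈ E` (nonempty), blown up with
the phase-2 centre `{old, D₀}`, and `S'` satisfies the round contract, then `Φ S' < Φ S`: the term of
`D₀` (at least `1`) disappears, the terms of the other old divisors do not increase, and the new
exceptional divisor contributes at most the old term of `D₀` minus one. [folklore] -/
theorem GameState.Φ_lt_of_roundSpec (hp : 1 ≤ p) (S : GameState p V₀ L V π)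
    (h1 : ∀ v, S.mOld v ≤ 1) (D₀ : V.IdealSheafData) (hD₀ : D₀ ∈ S.E) (hne : (S.W D₀).Nonempty)
    (hZ : IsClosed (S.W D₀)) {V' : Scheme.{0}} [IsIntegral V'] (φ : V' ⟶ V) [IsDominant (φ ≫ π)]
    (S' : GameState p V₀ L V' (φ ≫ π))
    (hRS : S.RoundSpec (S.W D₀) hZ
      (fun v hv => S.oldCh v ∪ {S.lab v ⟨D₀, hD₀, S.mem_support_of_chargedAt hv.2⟩}) φ S') :
    S'.Φ < S.Φ := by
  classical
  set C := Scheme.IdealSheafData.vanishingIdeal ⟨S.W D₀, hZ⟩ with hC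
  set sT := strictTransformIdeal φ C with hsT
  set T₀ := sSup ((fun v => S.Nval v D₀) '' S.W D₀) with hT₀
  -- the old term of `D₀` is at least `1`
  have hT₀1 : 1 ≤ T₀ := by
    obtain ⟨v, hv⟩ := hne
    exact (S.one_le_Nval_and_le hp v D₀).1.trans
      (le_csSup (S.bddAbove_Nval_image hp D₀ _) ⟨v, hv, rfl⟩)
  -- points of the new bad loci lie over points of the old ones, with the same resonance
  have hterm : ∀ D ∈ S.E, D ≠ D₀ →
      sSup ((fun x => S'.Nval x (sT D)) '' S'.W (sT D)) ≤ sSup ((fun v => S.Nval v D) '' S.W D) := by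
    intro D hD hDne
    refine nat_sSup_le_sSup_of_subset (S.bddAbove_Nval_image hp D _) ?_
    rintro _ ⟨x, ⟨hx1, hxch⟩, rfl⟩
    by_cases hx : φ x ∈ S.W D₀
    · obtain ⟨-, hothers, -⟩ := hRS.p2 x hx ⟨D₀, hD₀, S.mem_support_of_chargedAt hx.2⟩ hx.1 hx.2 rfl hx1
      obtain ⟨hiff, hN⟩ := hothers D hD hDne
      have hch : S.chargedAt D (φ x) := hiff.mp hxch
      refine ⟨φ x, ⟨hx.1, hch⟩, (hN hch).symm⟩
    · have hch : S.chargedAt D (φ x) := (hRS.off_charged x hx D hD).mp hxch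
      have hm : S.mOld (φ x) = 1 := by rw [← hRS.off_mOld x hx]; exact hx1
      exact ⟨φ x, ⟨hm, hch⟩, (hRS.off_Nval x hx D hD hch).symm⟩
  -- the strict transform of `D₀` has empty bad locus
  have hterm₀ : sSup ((fun x => S'.Nval x (sT D₀)) '' S'.W (sT D₀)) = 0 := by
    have hempty : S'.W (sT D₀) = ∅ := by
      ext x
      simp only [Set.mem_empty_iff_false, iff_false]
      rintro ⟨hx1, hxch⟩
      by_cases hx : φ x ∈ S.W D₀
      · obtain ⟨hnot, -, -⟩ := hRS.p2 x hx ⟨D₀, hD₀, S.mem_support_of_chargedAt hx.2⟩ hx.1 hx.2 rfl hx1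
        exact hnot hxch
      · have hch : S.chargedAt D₀ (φ x) := (hRS.off_charged x hx D₀ hD₀).mp hxch
        have hm : S.mOld (φ x) = 1 := by rw [← hRS.off_mOld x hx]; exact hx1
        exact hx ⟨hm, hch⟩
    rw [hempty, Set.image_empty]
    simp
  -- the new exceptional divisor contributes at most `T₀ - 1`
  have hexc : sSup ((fun x => S'.Nval x (C.comap φ)) '' S'.W (C.comap φ)) ≤ T₀ - 1 := by
    refine nat_sSup_le_of_forall_le _ ?_
    rintro _ ⟨x, ⟨hx1, hxch⟩, rfl⟩
    have hx : φ x ∈ S.W D₀ := by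
      by_contra hx
      exact hRS.off_exc x hx hxch
    obtain ⟨-, -, hnew⟩ := hRS.p2 x hx ⟨D₀, hD₀, S.mem_support_of_chargedAt hx.2⟩ hx.1 hx.2 rfl hx1
    have h : S'.Nval x (C.comap φ) + 1 = S.Nval (φ x) D₀ := hnew hxch
    have hle : S.Nval (φ x) D₀ ≤ T₀ := le_csSup (S.bddAbove_Nval_image hp D₀ _) ⟨φ x, hx, rfl⟩
    change S'.Nval x (C.comap φ) ≤ T₀ - 1
    omega
  -- assemble
  have h1' := h1
  unfold GameState.Φ
  rw [hRS.E_eq, List.map_append, List.sum_append, List.map_map]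
  simp only [List.map_cons, List.map_nil, List.sum_cons, List.sum_nil, add_zero]
  -- compare the sums over `S.E` termwise, with a saving of `T₀` at `D₀`
  set F : V.IdealSheafData → ℕ := fun D => sSup ((fun v => S.Nval v D) '' S.W D) with hF
  set F' : V.IdealSheafData → ℕ :=
    (fun D => sSup ((fun x => S'.Nval x D) '' S'.W D)) ∘ sT with hF'
  have hle : ∀ D ∈ S.E, F' D + (if D = D₀ then T₀ else 0) ≤ F D := by
    intro D hD
    by_cases hDD : D = D₀
    · subst hDD
      simp only [if_true, hF', Function.comp_apply]
      rw [hterm₀, zero_add]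
    · simp only [hDD, if_false, add_zero, hF', Function.comp_apply]
      exact hterm D hD hDD
  have hsum : (S.E.map F').sum + T₀ ≤ (S.E.map F).sum := by
    have h2 : (S.E.map fun D => F' D + (if D = D₀ then T₀ else 0)).sum ≤ (S.E.map F).sum :=
      List.sum_le_sum hle
    rw [List.sum_map_add] at h2
    have h3 : T₀ ≤ (S.E.map fun D => if D = D₀ then T₀ else 0).sum :=
      List.single_le_sum (fun _ _ => Nat.zero_le _) _ (List.mem_map.mpr ⟨D₀, hD₀, by simp⟩)
    omega
  change (S.E.map F').sum + sSup ((fun x => S'.Nval x (C.comap φ)) '' S'.W (C.comap φ)) < (S.E.map F).sum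
  omega

end PhaseTwo

end Summit.ResolutionOfSingularities.ResolutionOfSingularities.Theorems.RadicialJung.CleanModelsSuffice

end
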